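import Literature.AlgebraicGeometry.Frobenioids.PadicFrobenioidRmk122
import Literature.AlgebraicGeometry.Frobenioids.PadicFrobenioidTwistProofs
import Literature.AlgebraicGeometry.Frobenioids.PadicFrobenioidBadLocalKit
import Literature.AlgebraicGeometry.Frobenioids.PadicFrobenioidQp
import HarnessLib

/-!
# Frobenioids II, Example 1.1 (ii) / Remark 1.2.2: unit sections and `K_v`-relative embeddings EXIST
# (abc-iut cell, layer L1, §4(iii) non-vacuity; NV-L1 rows `PadicFrd.Datum.UnitSection`,
# `PadicFrd.RelEmb` of the kernel inhabitation censuses CENSUS-CELL-v3 / INHABITATION-CENSUS-L1-v1)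

Mochizuki, *The geometry of Frobenioids II: poly-Frobenioids*, Kyushu J. Math. **62** (2008) 401–460,
§1, Example 1.1 (ii) p. 8 and Remark 1.2.2 p. 10 [cite: MochizukiFrdII2008, Rmk 1.2.2 p.10]
[cite: MochizukiFrdII2008, Ex 1.1 (ii) p.8].

PROOF-ONLY file (no `def`, no `instance`, no `structure`): every witness is built inside a proof; the
frozen interfaces `PadicFrd.Datum.UnitSection` (abc-iut-L1-t4, `PadicFrobenioidRmk122.lean`) and
`PadicFrd.RelEmb` (abc-iut-L1-t4, `PadicFrobenioidBadLocalKit.lean`) are untouched.  Both were ZERO-producer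
rows of the two kernel censuses of 2026-08-26 (abc-iut-w5-d056 CENSUS-CELL-v3, 23 / 23 consumers;
abc-iut-w5-d197 INHABITATION-CENSUS-L1-v1): every typed statement of Remark 1.2.2 over a unit section
`s : d.UnitSection` (twisted splittings `u_D · τ`, the automorphism `U`, `Ψ_U`) and every statement of the
bad-place kit over `E : RelEmb base K_v` was, formally, consistent with these types being empty.

* **Unit sections** (GENUINE, label `_model`): for EVERY `p`-adic Frobenioid datum `d` (any base category
  `D`, any prime `p`) there is a section `u_D` of `O^×(−)` whose value at every `A_D` restricts to
  `1 + p ∈ O_{K_A}^×` — abc-iut-L1-t4's `Datum.exists_unitSection_onePlusP` (PadicFrobenioidTwistProofs)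
  repackaged into the interface (`Datum.exists_unitSection_onePlusP_model`); it is nowhere the trivial
  section (`Datum.exists_unitSection_ne_one`: `1 + p ≠ 1` since `p ≠ 0` in `K_A`), which is the case
  print's "`p ↦ p · u`, `u ∈ ℤ_p^×`" needs; the trivial section `u ≡ 1` is recorded too
  (`Datum.exists_unitSection_trivial`, label `_degenerate`); hence `Datum.nonempty_unitSection`, and the
  concrete instance at the `p`-adic Frobenioid of `ℚ_p` (`nonempty_unitSection_datumQp`).
* **`K_v`-relative embeddings** (GENUINE at a constant base, label `_model`): over the constant base at any
  `Spec K` the identity maps form a `K`-relative structure (`RelEmb.nonempty_const`); concretely over the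
  one-object base `Spec ℚ_p` (`RelEmb.nonempty_qpBase`), where moreover ALL standing hypotheses of the
  bad-place kit `BadLocalKit.datum` hold simultaneously with `q′ := p` (`BadLocalKit.hypotheses_at_qp`:
  `K_A` `p`-adic local, base connected and totally epimorphic, `q′` a non-unit) — so the kit's export is
  exercised by at least one input.

Honest framing: classical, undisputed mathematics; nothing here bears on [IUTchIII] Cor. 3.12; a zero row
is «not yet witnessed», never «vacuous»; typed ≠ proved.
-/

noncomputable section

namespace Literature.AlgebraicGeometry.Frobenioids

namespace PadicFrd

open CategoryTheory Opposite Function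

universe v u

/-! ### Remark 1.2.2: sections of `O^×(−)` exist for every datum -/

namespace Datum

variable {D : Type u} [Category.{v} D] {p : ℕ} [Fact p.Prime] (d : Datum D p)

/-- **A GENUINE unit section for every `p`-adic Frobenioid datum**: the section `A_D ↦ u_{A_D}` of
`O^×(−) = Ker(Div_B)` with `u_{A_D}|_{K^×} = 1 + p ∈ O_{K_{A_D}}^×`, compatible with all pull-backs
(abc-iut-L1-t4's `exists_unitSection_onePlusP`, packaged as a `UnitSection`).  Label: `_model`.
[cite: MochizukiFrdII2008, Rmk 1.2.2 p.10] -/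
theorem exists_unitSection_onePlusP_model :
    ∃ s : d.UnitSection, ∀ A : D,
      d.resK A (s.u A) ∈ unitSubgroup (d.fld A) ∧
        ((d.resK A (s.u A) : (d.fld A)ˣ) : d.fld A) = 1 + (p : ℕ) := by
  obtain ⟨u, hdiv, hmem, hval, hnat⟩ := d.exists_unitSection_onePlusP
  exact ⟨{ u := fun A => (u A : d.B.obj (op A)), divB_u := hdiv, map_u := fun f => hnat f },
    fun A => ⟨hmem A, hval A⟩⟩

/-- **The genuine section is nowhere trivial**: `u_{A_D} ≠ 1` at every `A_D` (as `p ≠ 0` in the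
`p`-adic field `K_{A_D}`).  This is the regime of print's "`p ∈ ℚ_p^×` is mapped to some `p · u`,
`u ∈ ℤ_p^×`". [cite: MochizukiFrdII2008, Rmk 1.2.2 p.10] -/
theorem exists_unitSection_ne_one : ∃ s : d.UnitSection, ∀ A : D, s.u A ≠ 1 := by
  obtain ⟨s, hs⟩ := d.exists_unitSection_onePlusP_model
  refine ⟨s, fun A h => ?_⟩
  have hval := (hs A).2
  rw [h, map_one, Units.val_one] at hval
  have hp : ((p : ℕ) : d.fld A) ≠ 0 := ((d.base.obj A).p_mem).2
  exact hp (by simpa using hval.symm)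

/-- The TRIVIAL section `u ≡ 1` (label `_degenerate`; recorded for completeness — `1 ∈ Ker(Div_B)` and
`B(f)(1) = 1`). [cite: MochizukiFrdII2008, Rmk 1.2.2 p.10] -/
theorem exists_unitSection_trivial : ∃ s : d.UnitSection, ∀ A : D, s.u A = 1 :=
  ⟨{ u := fun _ => 1, divB_u := fun _ => map_one _, map_u := fun _ => map_one _ }, fun _ => rfl⟩

/-- **NV-L1 row `PadicFrd.Datum.UnitSection`**: the type of unit sections of ANY `p`-adic Frobenioid datum
is inhabited (by the genuine `(1 + p)`-section). [cite: MochizukiFrdII2008, Rmk 1.2.2 p.10] -/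
theorem nonempty_unitSection :
    Nonempty (Literature.AlgebraicGeometry.Frobenioids.PadicFrd.Datum.UnitSection d) :=
  let ⟨s, _⟩ := d.exists_unitSection_ne_one; ⟨s⟩

end Datum

/-- **Concrete instance**: the `p`-adic Frobenioid of `ℚ_p` over the one-object base (abc-iut-L1-t4's
`datumQp`) carries a unit section with value `1 + p ∈ ℤ_p^×`, `≠ 1`. [cite: MochizukiFrdII2008, Rmk 1.2.2 p.10] -/
theorem nonempty_unitSection_datumQp (p : ℕ) [Fact p.Prime] :
    ∃ s : (datumQp p).UnitSection, ∀ A, s.u A ≠ 1 :=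
  (datumQp p).exists_unitSection_ne_one

/-! ### Example 1.1 (ii): `K_v`-relative structures exist -/

namespace RelEmb

variable {p : ℕ}

/-- **A GENUINE `K`-relative structure over a constant base**: over the base `D → D₀` constant at `Spec K`
(any category `D`, any `Spec K ∈ Ob(D₀)`), the identity maps `K → K_A = K` are valuative and compatible
with every arrow (all arrows map to `𝟙_{Spec K}`).  Label: `_model`. [cite: MochizukiFrdII2008, Ex 1.1 (ii) p.8] -/
theorem nonempty_const (D : Type u) [Category.{v} D] (X : PadicFld.{u} p) :
    Nonempty (Literature.AlgebraicGeometry.Frobenioids.PadicFrd.RelEmb ((Functor.const D).obj X) X.K) :=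
  ⟨{ emb := fun _ => RingHom.id X.K
     isValHom := fun _ _ _ => Iff.rfl
     comp := fun _ => by simp; rfl }⟩

/-- **Every value is hit**: for the constant-base structure the embeddings are bijective (they are the
identity), so `K_v → K_A` is an isomorphism at every `A` — the extreme opposite of degenerate.
[cite: MochizukiFrdII2008, Ex 1.1 (ii) p.8] -/
theorem exists_const_bijective (D : Type u) [Category.{v} D] (X : PadicFld.{u} p) :
    ∃ E : RelEmb ((Functor.const D).obj X) X.K, ∀ A, Bijective (E.emb A) :=
  ⟨{ emb := fun _ => RingHom.id X.K
     isValHom := fun _ _ _ => Iff.rfl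
     comp := fun _ => by simp; rfl }, fun _ => bijective_id⟩

/-- **NV-L1 row `PadicFrd.RelEmb`, concretely**: the `ℚ_p`-relative structure on the one-object base
`Spec ℚ_p` (abc-iut-L1-t4's `qpBase`). [cite: MochizukiFrdII2008, Ex 1.1 (ii) p.8] -/
theorem nonempty_qpBase (p : ℕ) [Fact p.Prime] :
    Nonempty (Literature.AlgebraicGeometry.Frobenioids.PadicFrd.RelEmb (qpBase p) ℚ_[p]) :=
  nonempty_const (Discrete PUnit.{1}) (qpFld p)

end RelEmb

/-- **The bad-place kit is exercised**: at `K_v = ℚ_p` over the one-object base, with `q′ := p`, ALL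
standing inputs of `BadLocalKit.datum` / `BadLocalKit.Cdash` hold at once — a `ℚ_p`-relative structure,
every `K_A` `p`-adic local, the base connected and totally epimorphic, and `q′ = p` a NON-unit of
`O_{ℚ_p}^⊳` (`v(p) < 1`).  (Honest scope: this is the split/degenerate-base instance; the genuine
[IUTchI] Ex. 3.2 base `D_v` is abc-iut-L5's.) [cite: MochizukiFrdII2008, Ex 1.1 (ii) p.8] -/
theorem BadLocalKit.hypotheses_at_qp (p : ℕ) [Fact p.Prime] :
    ∃ (_E : RelEmb (qpBase p) ℚ_[p]) (q' : intNonzero ℚ_[p]),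
      (∀ A : Discrete PUnit.{1}, ((qpBase p).obj A).IsPadicLocal) ∧
        IsConnected (Discrete PUnit.{1}) ∧ IsTotallyEpimorphic (Discrete PUnit.{1}) ∧ ¬ IsUnit q' := by
  obtain ⟨E⟩ := RelEmb.nonempty_qpBase p
  refine ⟨E, ⟨(p : ℚ_[p]), p_mem_intNonzero p⟩, fun _ => isPadicLocal_qpFld p, inferInstance,
    isTotallyEpimorphic_discretePUnit, fun h => ?_⟩
  have h1 := (isUnit_intNonzero_iff ℚ_[p] _).mp h
  exact (qpFld p).p_lt.ne h1

end PadicFrd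

end Literature.AlgebraicGeometry.Frobenioids
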